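import Summits.QuantumFields.YangMills.Theorems.IR.AfPincerUcXCovCompact

/-!
# Crux `IR` (stmt-QuantumFields-19354), line `af-pincer`, stub `stub_afOnsetUc : AFToOnsetUKPc` (X-side):
# the pincer END TO END at `(G, r, a)` from the asymptotic-freedom window — no crossover envelope with a compact witness

Third file of `Theorems/IR/AfPincerUcXCov{,Compact,Pincer}` (seat ym-19354-afpincer-s2, generation 2).  The slot's generic
seams `fmtOnset_pinned` / `gapInUnits_of_fmtOnset` (`Theorems/IR/AfPincerUcFormat` §A) consume the X-side only for the
ONE test function `v` of the non-triviality input `LowerBounds`(i).  Combining them with §2 of `…XCovCompact`: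

* **`gapInUnits_of_window_format_clustering_of_compactWitness`** — at a parameter `(G, r, a, n, ε, δ₀)`: the E-side
  clustering contract `FmtClustering r (TypShellCondUKPc … n ε δ₀) κ s₀` (`κ > 0`), the LEAD's format at a mesh
  `≤ B·ℓ(β)` eventually, the asymptotic-freedom WINDOW at scale `ℓ` and a COMPACTLY SUPPORTED non-triviality witness
  (`LowerBounds`(i) with `HasCompactSupport v`) give `GapInUnits G r a` — the conclusion of crux `IR` at `(G, r, a)` —
  with NO crossover envelope and NO use of the registered X-stub;
* `gapInUnits_of_envelope_window_format_clustering` — the same with a general Schwartz witness (`LowerBounds G r a`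
  itself), paying the crossover ENVELOPE (via `afBelowScale_of_covarianceAF`).

Caveat on the envelope (correcting a phrase of `…XCov`'s docstring): beyond `‖x−y‖ ≳ ℓ log ℓ` the envelope would follow from
TRANSLATION-UNIFORM exponential clustering at rate `κ/ℓ`; the slot's E∘I output (`FmtClustering`, one constant per species pair,
time separations) is not uniform over spatial offsets and does not by itself supply it.

Reading for the planners (no registry change implied): the intended NT supplier's witnesses are bumps (line
`dlr-collar-transfer`, `Statement.stub_lower`: «`v ≥ 0` a bump at height `s/2`»), hence compactly supported; typed that
way, the X-side of the pincer owes exactly the WINDOW «`|Cov_{β,L}(A_x,A_y)| (1+‖x−y‖)⁸ → 0` uniformly on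
`T'‖x − y‖ ≤ ℓ(β)` as `T' → ∞`» at the LEAD's scale `ℓ` — a UV-desk statement when `ℓ = ℓ_AF`.

HONEST FRAMING.  Kernel compositions of OPEN hypotheses (clustering contract, format at scale, AF window, NT witness);
nothing here is proved about Yang–Mills; one open gap-crux of a CONDITIONAL chain (Track A 0/28 UV); not a gap claim.
-/

set_option autoImplicit false

noncomputable section

open Filter Topology Finset MeasureTheory
open scoped BigOperators SchwartzMap
open Literature.MathematicalPhysics.QuantumFieldTheory hiding ZdEdge
open Literature.MathematicalPhysics.QuantumLattice
open Literature.Probability.LatticeModels (Site box mem_box)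
open Summit.QuantumFields.YangMills.Cruxes.OSLegsFromFemtoAndGap.DlrCollarTransfer
open Summit.QuantumFields.YangMills.Cruxes.IR.AfOnset

namespace Summit.QuantumFields.YangMills.Cruxes.IR.AfPincerUc

variable {G : Type} [Group G] [TopologicalSpace G] [IsTopologicalGroup G] [CompactSpace G]
  [MeasurableSpace G] [BorelSpace G]

/-! ## §5 Pinning and the gap from the window, for one witness -/
section Pincer

/-- **Pinning for ONE witness** (the slot's `fmtOnset_pinned`, witness-local form): if `Q2(θv, v)` at unit `a(β)` stays
`≥ ε₅ > 0` on all large tori (the witness clause of `LowerBounds`(i)) and is `≤ ε₅/2` frequently whenever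
`T ≤ a(β)·ℓ(β)`, then `a(β)·ℓ(β) < T` for all large `β`. [folklore] -/
theorem scale_pinned_of_witness (r : LatticeRep G) (a ℓ : ℝ → ℝ) (ha : ∀ β, 0 < a β)
    {v : 𝓢(EuclideanSpace ℝ (Fin 4), ℝ)} {ε₅ β₅ Λ₅ : ℝ}
    (hlow : ∀ β : ℝ, β₅ ≤ β → ∀ L : ℕ, Λ₅ ≤ a β * L → ε₅ ≤ Q2 G r β L (a β) (thetaTest 4 v) v)
    {T β₁ : ℝ} (hX : ∀ β : ℝ, β₁ ≤ β → ∀ s : ℝ, 0 < s → T ≤ s * ℓ β →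
      ∃ᶠ (L : ℕ) in atTop, |Q2 G r β L s (thetaTest 4 v) v| ≤ ε₅ / 2) (hε₅ : 0 < ε₅) :
    ∀ β : ℝ, max β₁ β₅ ≤ β → a β * ℓ β < T := by
  intro β hβ
  have hβ1 : β₁ ≤ β := le_trans (le_max_left _ _) hβ
  have hβ5 : β₅ ≤ β := le_trans (le_max_right _ _) hβ
  by_contra hge
  rw [not_lt] at hge
  have hfreq := hX β hβ1 (a β) (ha β) hge
  have hev : ∀ᶠ (L : ℕ) in atTop, Λ₅ ≤ a β * (L : ℝ) :=
    (tendsto_natCast_atTop_atTop.const_mul_atTop (ha β)).eventually_ge_atTop Λ₅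
  obtain ⟨L, hL1, hL2⟩ := (hfreq.and_eventually hev).exists
  have hlo := hlow β hβ5 L hL2
  have habs := le_abs_self (Q2 G r β L (a β) (thetaTest 4 v) v)
  linarith

/-- **The IR conclusion at `(G, r, a)` from WINDOW + FORMAT-AT-SCALE + CLUSTERING with a COMPACTLY SUPPORTED witness —
no crossover envelope, no X-stub.**  Inputs at the parameter `(n, ε, δ₀)` and a shared scale `ℓ`:
the E-side clustering contract at rate `κ > 0`; the LEAD's «format `TypShellCondUKPc` at a mesh `b ≤ B·ℓ(β)` for all
large `β`»; the asymptotic-freedom window at scale `ℓ`; `LowerBounds`(i) with a compactly supported witness `v`.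
Output: `GapInUnits G r a` (via `afBelowScale_clause_of_covarianceAF_of_compact`, `scale_pinned_of_witness` and the
slot's `gapInUnits_of_fmtOnset`, with the onset `mixOnsetUc ≤ b ≤ B·ℓ` pinned below `B·T/a(β)`).
[kernel composition; every hypothesis is OPEN] -/
theorem gapInUnits_of_window_format_clustering_of_compactWitness (r : LatticeRep G) (a ℓ : ℝ → ℝ)
    (ha : ∀ β, 0 < a β) {n : ℕ} {ε δ₀ κ : ℝ} {s₀ : ℕ} (hκ : 0 < κ)
    (hcl : FmtClustering r (fun β b => TypShellCondUKPc r.ρ β b n ε δ₀) κ s₀)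
    (hF : ∃ B β₂ : ℝ, 0 < B ∧ ∀ β : ℝ, β₂ ≤ β → ∃ b : ℕ, 1 ≤ b ∧ (b : ℝ) ≤ B * ℓ β ∧ TypShellCondUKPc r.ρ β b n ε δ₀)
    (haf : ∀ W : ℝ, 0 < W → ∃ T' β₀ : ℝ, 0 < T' ∧ ∀ β : ℝ, β₀ ≤ β → ∀ᶠ L : ℕ in atTop,
      ∀ x ∈ box 4 L, ∀ y ∈ box 4 L, ‖x - y‖ ≤ (L : ℝ) → T' * ‖x - y‖ ≤ ℓ β →
        |torusE G r β L (fun U => dens G r x U * dens G r y U) -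
            torusE G r β L (dens G r x) * torusE G r β L (dens G r y)| ≤ W / (1 + ‖x - y‖) ^ 8)
    (hlbc : ∃ (v : 𝓢(EuclideanSpace ℝ (Fin 4), ℝ)) (ε₅ β₅ Λ₅ : ℝ),
      tsupport v ⊆ {y : EuclideanSpace ℝ (Fin 4) | 0 < y 0} ∧ HasCompactSupport v ∧ 0 < ε₅ ∧
        ∀ β : ℝ, β₅ ≤ β → ∀ L : ℕ, Λ₅ ≤ a β * L → ε₅ ≤ Q2 G r β L (a β) (thetaTest 4 v) v) :
    GapInUnits G r a := by
  obtain ⟨v, ε₅, β₅, Λ₅, hv, hvc, hε₅, hlow⟩ := hlbc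
  obtain ⟨T, β₁, hT⟩ := afBelowScale_clause_of_covarianceAF_of_compact r ℓ haf v hv hvc (half_pos hε₅)
  have hpinℓ := scale_pinned_of_witness r a ℓ ha hlow hT hε₅
  obtain ⟨B, β₂, hB, hFβ⟩ := hF
  -- the onset is pinned: `a β · mixOnsetUc ≤ a β · B ℓ β < B T`
  have hpin : ∀ β : ℝ, max (max β₁ β₅) β₂ ≤ β →
      a β * (fmtOnset (fun β' b => TypShellCondUKPc r.ρ β' b n ε δ₀) β : ℝ) < B * T := by
    intro β hβ
    have hβ15 : max β₁ β₅ ≤ β := le_trans (le_max_left _ _) hβ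
    have hβ2 : β₂ ≤ β := le_trans (le_max_right _ _) hβ
    obtain ⟨b, hb1, hbℓ, hP⟩ := hFβ β hβ2
    have hle : fmtOnset (fun β' b => TypShellCondUKPc r.ρ β' b n ε δ₀) β ≤ b :=
      fmtOnset_le (fun β' b => TypShellCondUKPc r.ρ β' b n ε δ₀) β hb1 hP
    have hle' : (fmtOnset (fun β' b => TypShellCondUKPc r.ρ β' b n ε δ₀) β : ℝ) ≤ (b : ℝ) := by exact_mod_cast hle
    have h1 := hpinℓ β hβ15
    calc a β * (fmtOnset (fun β' b => TypShellCondUKPc r.ρ β' b n ε δ₀) β : ℝ) ≤ a β * (B * ℓ β) :=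
          mul_le_mul_of_nonneg_left (hle'.trans hbℓ) (ha β).le
      _ = B * (a β * ℓ β) := by ring
      _ < B * T := mul_lt_mul_of_pos_left h1 hB
  have hon : ∀ β : ℝ, β₂ ≤ β → (fmtSet (fun β' b => TypShellCondUKPc r.ρ β' b n ε δ₀) β).Nonempty := by
    intro β hβ
    obtain ⟨b, hb1, -, hP⟩ := hFβ β hβ
    exact ⟨b, hb1, hP⟩
  exact gapInUnits_of_fmtOnset r a ha hκ hcl hon hpin

/-- **The IR conclusion at `(G, r, a)` from ENVELOPE + WINDOW + FORMAT-AT-SCALE + CLUSTERING with a general witness**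
(`LowerBounds G r a` as registered): as above, paying the crossover envelope for the Schwartz tails of the witness
(via `afBelowScale_of_covarianceAF`; cplan g10's `ir_of_sharpOnset` route in covariance clothes).
[kernel composition; every hypothesis is OPEN] -/
theorem gapInUnits_of_envelope_window_format_clustering (r : LatticeRep G) (a ℓ : ℝ → ℝ)
    (ha : ∀ β, 0 < a β) {n : ℕ} {ε δ₀ κ : ℝ} {s₀ : ℕ} (hκ : 0 < κ)
    (hcl : FmtClustering r (fun β b => TypShellCondUKPc r.ρ β b n ε δ₀) κ s₀)
    (hF : ∃ B β₂ : ℝ, 0 < B ∧ ∀ β : ℝ, β₂ ≤ β → ∃ b : ℕ, 1 ≤ b ∧ (b : ℝ) ≤ B * ℓ β ∧ TypShellCondUKPc r.ρ β b n ε δ₀)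
    (henv : ∃ W₀ β₀ : ℝ, ∀ β : ℝ, β₀ ≤ β → ∀ᶠ L : ℕ in atTop, ∀ x ∈ box 4 L, ∀ y ∈ box 4 L,
      ‖x - y‖ ≤ (L : ℝ) →
        |torusE G r β L (fun U => dens G r x U * dens G r y U) -
            torusE G r β L (dens G r x) * torusE G r β L (dens G r y)| ≤ W₀ / (1 + ‖x - y‖) ^ 8)
    (haf : ∀ W : ℝ, 0 < W → ∃ T' β₀ : ℝ, 0 < T' ∧ ∀ β : ℝ, β₀ ≤ β → ∀ᶠ L : ℕ in atTop,
      ∀ x ∈ box 4 L, ∀ y ∈ box 4 L, ‖x - y‖ ≤ (L : ℝ) → T' * ‖x - y‖ ≤ ℓ β →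
        |torusE G r β L (fun U => dens G r x U * dens G r y U) -
            torusE G r β L (dens G r x) * torusE G r β L (dens G r y)| ≤ W / (1 + ‖x - y‖) ^ 8)
    (hlb : LowerBounds G r a) : GapInUnits G r a := by
  obtain ⟨⟨v, ε₅, β₅, Λ₅, hv, hε₅, hlow⟩, -⟩ := hlb
  obtain ⟨T, β₁, hT⟩ := afBelowScale_of_covarianceAF r ℓ henv haf v hv (half_pos hε₅)
  have hpinℓ := scale_pinned_of_witness r a ℓ ha hlow hT hε₅
  obtain ⟨B, β₂, hB, hFβ⟩ := hF
  have hpin : ∀ β : ℝ, max (max β₁ β₅) β₂ ≤ β →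
      a β * (fmtOnset (fun β' b => TypShellCondUKPc r.ρ β' b n ε δ₀) β : ℝ) < B * T := by
    intro β hβ
    have hβ15 : max β₁ β₅ ≤ β := le_trans (le_max_left _ _) hβ
    have hβ2 : β₂ ≤ β := le_trans (le_max_right _ _) hβ
    obtain ⟨b, hb1, hbℓ, hP⟩ := hFβ β hβ2
    have hle : fmtOnset (fun β' b => TypShellCondUKPc r.ρ β' b n ε δ₀) β ≤ b :=
      fmtOnset_le (fun β' b => TypShellCondUKPc r.ρ β' b n ε δ₀) β hb1 hP
    have hle' : (fmtOnset (fun β' b => TypShellCondUKPc r.ρ β' b n ε δ₀) β : ℝ) ≤ (b : ℝ) := by exact_mod_cast hle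
    have h1 := hpinℓ β hβ15
    calc a β * (fmtOnset (fun β' b => TypShellCondUKPc r.ρ β' b n ε δ₀) β : ℝ) ≤ a β * (B * ℓ β) :=
          mul_le_mul_of_nonneg_left (hle'.trans hbℓ) (ha β).le
      _ = B * (a β * ℓ β) := by ring
      _ < B * T := mul_lt_mul_of_pos_left h1 hB
  have hon : ∀ β : ℝ, β₂ ≤ β → (fmtSet (fun β' b => TypShellCondUKPc r.ρ β' b n ε δ₀) β).Nonempty := by
    intro β hβ
    obtain ⟨b, hb1, -, hP⟩ := hFβ β hβ
    exact ⟨b, hb1, hP⟩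
  exact gapInUnits_of_fmtOnset r a ha hκ hcl hon hpin

end Pincer

end Summit.QuantumFields.YangMills.Cruxes.IR.AfPincerUc

end
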